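import Summits.PneNP.PneNP.Theorems.ChebyshevTracialDesignCrossingPlaneBulkConditional
import Summits.PneNP.PneNP.Theorems.ChebyshevTracialDesignBulkNumerics
import Literature.Combinatorics.Optimization.ShellLawRelativeLevelSmoothness
import Literature.Combinatorics.Optimization.ShellLawWindowLowerBound
import HarnessLib

/-!
# Cell pnp-psdrank, route `ChebyshevTracialDesign`: (CG_1′) IN THE CROSSING PLANE, [BULK] DISCHARGED — brick 124
# (crux `TracialDecayExp20`, stmt-PneNP-19878)

Brick 124 (prover g24; MEMO-26 §7). Brick 123 (`crossingPlane_value_le_of_relSmooth_window`) bounds the tilted (CG_1′)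
value of a nonnegative block statistic in every crossing-plane direction, per matching, by brick 120's seven pure
remainders plus `2^{D+1}·9t²G·(D+1)·2(n/2+1)³·e^{−ε²/|H|}`, CONDITIONAL on [BULK]: pointwise relative level-smoothness
of the shell laws at every `x ∈ [0,t]` with `|x − t|H|/n| < ε`. This file DISCHARGES [BULK] for large `n`:
Literature `ShellLawRelativeLevelSmoothness.relSmooth_of_hyps` (Step 1 singleton-window level smoothing ∘
re-insertion ∘ per-ground-set good/far bound) under explicit numeric inequalities, Literature
`ShellLawWindowLowerBound.shellLaw_one_window_lower` (lit g35: the window lower bound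
`e^{−8(Λ+10)²/(β⁴(N₀−1))}/(2048N₀²) ≤ law(t,1;x)`), and `ChebyshevTracialDesignBulkNumerics.bulk_numerics` (all the
numeric inequalities hold once `(n/2)^{1/8} ≥ P*(β,K)`, `D⁴ ≤ n`).

* **`crossingPlane_value_le`**: for every `β > 0` (type margin) and `K ≥ 0` (window constant) there is `n₀` such
  that for all `n ≥ n₀`, every BALANCED exact design (`IsExactDesign n t T D …`, `n ≤ 4t`, `2D+1 ≤ T`, `1 ≤ D`,
  `D⁴ ≤ n`), every perfect matching `M` and block `H` whose `H`-type `(a,b,d)` has `a, b, d ≥ β·n/2 + 2D + 1`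
  (the NON-ALIGNED matchings), every `0 ≤ ψ ≤ G` and crossing-plane direction `(λ, κ)`, and every admissible
  remainder family `X` (as in brick 120): the conclusion of brick 123 holds with `ε = K·√(|H|·D)`, i.e. with the
  tail term `2^{D+1}·9t²G·(D+1)·2(n/2+1)³·e^{−K²D}` — UNCONDITIONALLY.
READING: with `K² > ln 2 + a′` this is the per-matching (CG_1′) in the crossing plane at `e^{−a′D}` for non-aligned
matchings (MEMO-25 §4 (O1)+(O2)); the `X_k` remainders are priced by bricks 117/118. WHAT THIS FILE DOES NOT DO:
directions outside the crossing plane ((O3)); aligned matchings; anything on `TracialDecayExp20` itself, psd rank of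
P_PM(K_n), or P vs NP. [cite: Rothvoss2017, §2 (PDF p. 6)] [cite: RollinRoss2010, §3 Lemma 3.1, 3.3; §4.1 Thm 4.2]
[cite: Agarwal2000DifferenceEquations, Thm. 1.8.5 (1.8.6), Remark 1.8.1]
Stature: support/instrument (kernel lane, no defs, axioms standard). Supports stmt-PneNP-19878.
-/

set_option linter.dupNamespace false -- `Summit.PneNP.PneNP.…`: summit = sub-problem (D-0017)

noncomputable section

namespace Summit.PneNP.PneNP.Theorems.ChebyshevTracialDesignCrossingPlaneUnconditional

open Finset Polynomial Literature.Barriers.PneNP Literature.Combinatorics.Optimization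
open Literature.Combinatorics.Optimization.ShellStep
open Summit.PneNP.PneNP.Theorems.ChebyshevTracialDesignCrossingPlaneBulkConditional
  (crossingPlane_value_le_of_relSmooth_window)
open Summit.PneNP.PneNP.Theorems.ChebyshevTracialDesignShellOperatorForm (shell_partner_nonempty)
open Summit.PneNP.PneNP.Theorems.ChebyshevTracialDesignBulkNumerics (bulk_numerics)

variable {n : ℕ}

/-- From `P* ≤ N₀^{1/8}`'s witness: if `P*^8 ≤ N₀` (`P* ≥ 0`) then `P* ≤ N₀^{1/8}`. [cite: RollinRoss2010, §4.1 Thm 4.2] -/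
theorem le_rpow_inv_eight {Pstar N₀ : ℝ} (hP : 0 ≤ Pstar) (h : Pstar ^ 8 ≤ N₀) : Pstar ≤ N₀ ^ ((8 : ℕ) : ℝ)⁻¹ := by
  have h0 : 0 ≤ N₀ := le_trans (by positivity) h
  calc Pstar = (Pstar ^ 8) ^ ((8 : ℕ) : ℝ)⁻¹ := (Real.pow_rpow_inv_natCast hP (by norm_num)).symm
    _ ≤ N₀ ^ ((8 : ℕ) : ℝ)⁻¹ := Real.rpow_le_rpow (by positivity) h (by positivity)

/-- The centre transfer at `k = 0`: `|x − (2s+1)P/(2N₀)| < ε` with `0 ≤ P ≤ 2N₀` gives `|x − sP/N₀| ≤ ε + 1`.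
[cite: Rothvoss2017, §2 (PDF p. 6)] -/
theorem window_centre {x s P N₀ ε : ℝ} (hN : 0 < N₀) (hP0 : 0 ≤ P) (hP : P ≤ 2 * N₀)
    (h : |x - (2 * s + 1) * P / (2 * N₀)| < ε) : |x - s * P / N₀| ≤ ε + 1 := by
  have e : x - s * P / N₀ = (x - (2 * s + 1) * P / (2 * N₀)) + P / (2 * N₀) := by field_simp; ring
  rw [e]
  have h1 : |P / (2 * N₀)| ≤ 1 := by
    rw [abs_of_nonneg (by positivity), div_le_one (by positivity)]; linarith
  have := abs_add_le (x - (2 * s + 1) * P / (2 * N₀)) (P / (2 * N₀))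
  linarith

/-- **(CG_1′) IN THE CROSSING PLANE FOR NON-ALIGNED MATCHINGS, UNCONDITIONALLY (brick 124 = brick 123 with [BULK]
discharged).** For every `β > 0` and `K ≥ 0` there is `n₀` such that for all `n ≥ n₀`: for every balanced exact
design with `t = t₁ + 2(D+1) + 2`, `n ≤ 4t`, `2D+1 ≤ T`, `1 ≤ D`, `D⁴ ≤ n`, every perfect matching `M` and block `H`
with `H`-type margins `β·n/2 + 2D + 1 ≤ a, b, d`, every `0 ≤ ψ ≤ G` on `[0,t]`, `|λ|, |κ| ≤ 1`, and every admissible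
remainder family `X`,
`|PM|·Σ_U W(U,M)·ψ(|U∩H|)·(Σ_p u_p x_p x_{πp})² ≤ R + 2^{D+1}·9t²G·((D+1)·2(n/2+1)³·e^{−(K√(|H|D))²/|H|})`.
[cite: Rothvoss2017, §2 (PDF p. 6)] [cite: RollinRoss2010, §3 Lemma 3.1, 3.3] -/
theorem crossingPlane_value_le {β K : ℝ} (hβ : 0 < β) (hK : 0 ≤ K) :
    ∃ n₀ : ℕ, ∀ n : ℕ, n₀ ≤ n → ∀ {t₁ T D : ℕ} {Bv : ℝ} {C : Finset ℕ} {w : ℕ → ℝ},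
    IsExactDesign n (t₁ + 2 * (D + 1) + 2) T D Bv C w → 2 * D + 1 ≤ T → n ≤ 4 * (t₁ + 2 * (D + 1) + 2) →
    1 ≤ D → D ^ 4 ≤ n → ∀ (M : PMatch n) (H : Finset (Fin n)),
    β * n / 2 + 2 * D + 1 ≤ (reps M.2.partner (vAA M.2.partner univ H)).card →
    β * n / 2 + 2 * D + 1 ≤ (reps M.2.partner (vBH M.2.partner univ H ∪ vBN M.2.partner univ H)).card →
    β * n / 2 + 2 * D + 1 ≤ (reps M.2.partner (vDD M.2.partner univ H)).card →
    ∀ (ψ : ℤ → ℝ) {G : ℝ}, 0 ≤ G →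
    (∀ x ∈ Icc (0 : ℤ) ((t₁ + 2 * (D + 1) + 2 : ℕ) : ℤ), |ψ x| ≤ G) →
    ∀ (lam kap : ℝ), |lam| ≤ 1 → |kap| ≤ 1 →
    ∀ {m : ℕ}, 3 ≤ m → m + 4 * (D + 1) + 4 ≤ n → ∀ (X : ℕ → ℝ), (∀ k, 0 ≤ X k) →
    (∀ k, k ≤ D + 1 → ∀ e, e ≤ 2 → ∀ c' : ℕ, c' + 2 * k ≤ T → ∀ S' : Finset (Fin n), (∀ u ∈ S', M.2.partner u ∈ S') →
      S'.card + 4 * k + 2 * e = n →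
      ∑ x ∈ Icc (0 : ℤ) ((t₁ + 2 * (D + 1) + 2 - e : ℕ) : ℤ),
        |nab2^[k] (fun c x => shellLaw M.2.partner S' H (t₁ + 2 * (D + 1) + 2 - e - 2 * k) c x : Profile) c' x| ≤ X k) →
    (∀ x ∈ Icc (0 : ℤ) ((t₁ + 2 * (D + 1) + 2 : ℕ) : ℤ), 0 ≤ ψ x) →
    (Fintype.card (PMatch n) : ℝ) * ∑ U : OddSet n, levelWeight n (t₁ + 2 * (D + 1) + 2) C w U M *
        (ψ ((U.1 ∩ H).card : ℤ) *
          (∑ p : Fin n, (lam * ((if (p ∈ H ∧ M.2.partner p ∈ H) then (1 : ℝ) else 0) -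
              (if (p ∉ H ∧ M.2.partner p ∉ H) then (1 : ℝ) else 0)) + (lam + kap)) *
            ((if p ∈ U.1 then (1 : ℝ) else 0) * (if M.2.partner p ∈ U.1 then (1 : ℝ) else 0))) ^ 2) ≤
      (Bv * ((((T - 1) / 2).choose (D + 1) : ℕ) : ℝ) *
          ((9 * ((t₁ + 2 * (D + 1) + 2 : ℕ) : ℝ) ^ 2 * G) * (((m : ℝ) / (4 * ((m : ℝ) - 2))) ^ (D + 1) * X (D + 1))) +
      2 * ((2 * (D : ℝ) + 1) * ((((2 * D).choose D : ℕ) : ℝ) / (4 : ℝ) ^ D) *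
            ((3 * ((t₁ + 2 * (D + 1) + 2 : ℕ) : ℝ) * G) * (((m : ℝ) / (4 * ((m : ℝ) - 2))) ^ D * X D)) +
          Bv * ((((T - 1) / 2).choose (D + 1) : ℕ) : ℝ) *
            ((T : ℝ) * ((3 * ((t₁ + 2 * (D + 1) + 2 : ℕ) : ℝ) * G) * (((m : ℝ) / (4 * ((m : ℝ) - 2))) ^ (D + 1) * X (D + 1))) +
              2 * ((D : ℝ) + 1) * ((3 * ((t₁ + 2 * (D + 1) + 2 : ℕ) : ℝ) * G) * (((m : ℝ) / (4 * ((m : ℝ) - 2))) ^ D * X D)))) +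
      ((2 * (D : ℝ) + 1) * ((((2 * D).choose D : ℕ) : ℝ) / (4 : ℝ) ^ D) *
          ((T : ℝ) * (G * (((m : ℝ) / (4 * ((m : ℝ) - 2))) ^ D * X D)) +
            2 * (D : ℝ) * (G * (((m : ℝ) / (4 * ((m : ℝ) - 2))) ^ (D - 1) * X (D - 1)))) +
        Bv * ((((T - 1) / 2).choose (D + 1) : ℕ) : ℝ) *
          ((T : ℝ) * ((T : ℝ) * (G * (((m : ℝ) / (4 * ((m : ℝ) - 2))) ^ (D + 1) * X (D + 1))) +
              2 * ((D : ℝ) + 1) * (G * (((m : ℝ) / (4 * ((m : ℝ) - 2))) ^ D * X D))) +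
            2 * ((D : ℝ) + 1) * ((T : ℝ) * (G * (((m : ℝ) / (4 * ((m : ℝ) - 2))) ^ D * X D)) +
              2 * (D : ℝ) * (G * (((m : ℝ) / (4 * ((m : ℝ) - 2))) ^ (D - 1) * X (D - 1)))))) +
      4 * ((2 * (D : ℝ) + 1) * ((((2 * D).choose D : ℕ) : ℝ) / (4 : ℝ) ^ D) *
            (((H.card : ℝ) / n) * ((3 * ((t₁ + 2 * (D + 1) + 2 : ℕ) : ℝ) * G) * (((m : ℝ) / (4 * ((m : ℝ) - 2))) ^ D * X D))) +
          Bv * ((((T - 1) / 2).choose (D + 1) : ℕ) : ℝ) *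
            ((T : ℝ) * (((H.card : ℝ) / n) * ((3 * ((t₁ + 2 * (D + 1) + 2 : ℕ) : ℝ) * G) *
                (((m : ℝ) / (4 * ((m : ℝ) - 2))) ^ (D + 1) * X (D + 1)))) +
              2 * ((D : ℝ) + 1) * (((H.card : ℝ) / n) * ((3 * ((t₁ + 2 * (D + 1) + 2 : ℕ) : ℝ) * G) *
                (((m : ℝ) / (4 * ((m : ℝ) - 2))) ^ D * X D))))) +
      4 * ((2 * (D : ℝ) + 1) * ((((2 * D).choose D : ℕ) : ℝ) / (4 : ℝ) ^ D) *
            ((T : ℝ) * (((H.card : ℝ) / n) * (G * (((m : ℝ) / (4 * ((m : ℝ) - 2))) ^ D * X D))) +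
              2 * (D : ℝ) * (((H.card : ℝ) / n) * (G * (((m : ℝ) / (4 * ((m : ℝ) - 2))) ^ (D - 1) * X (D - 1))))) +
          Bv * ((((T - 1) / 2).choose (D + 1) : ℕ) : ℝ) *
            ((T : ℝ) * ((T : ℝ) * (((H.card : ℝ) / n) * (G * (((m : ℝ) / (4 * ((m : ℝ) - 2))) ^ (D + 1) * X (D + 1)))) +
                2 * ((D : ℝ) + 1) * (((H.card : ℝ) / n) * (G * (((m : ℝ) / (4 * ((m : ℝ) - 2))) ^ D * X D)))) +
              2 * ((D : ℝ) + 1) * ((T : ℝ) * (((H.card : ℝ) / n) * (G * (((m : ℝ) / (4 * ((m : ℝ) - 2))) ^ D * X D))) +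
                2 * (D : ℝ) * (((H.card : ℝ) / n) * (G * (((m : ℝ) / (4 * ((m : ℝ) - 2))) ^ (D - 1) * X (D - 1))))))) +
      4 * ((2 * (D : ℝ) + 1) * ((((2 * D).choose D : ℕ) : ℝ) / (4 : ℝ) ^ D) *
            (((H.card : ℝ) / n) * (G * (((m : ℝ) / (4 * ((m : ℝ) - 2))) ^ D * X D))) +
          Bv * ((((T - 1) / 2).choose (D + 1) : ℕ) : ℝ) *
            ((T : ℝ) * (((H.card : ℝ) / n) * (G * (((m : ℝ) / (4 * ((m : ℝ) - 2))) ^ (D + 1) * X (D + 1)))) +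
              2 * ((D : ℝ) + 1) * (((H.card : ℝ) / n) * (G * (((m : ℝ) / (4 * ((m : ℝ) - 2))) ^ D * X D))))) +
      4 * ((2 * (D : ℝ) + 1) * ((((2 * D).choose D : ℕ) : ℝ) / (4 : ℝ) ^ D) *
            (((H.card : ℝ) ^ 2 / ((n : ℝ) * ((n : ℝ) - 2))) * (G * ((T : ℝ) * (((m : ℝ) / (4 * ((m : ℝ) - 2))) ^ D * X D) +
              2 * (D : ℝ) * (((m : ℝ) / (4 * ((m : ℝ) - 2))) ^ (D - 1) * X (D - 1))))) +
          Bv * ((((T - 1) / 2).choose (D + 1) : ℕ) : ℝ) *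
            ((T : ℝ) * (((H.card : ℝ) ^ 2 / ((n : ℝ) * ((n : ℝ) - 2))) *
                (G * ((T : ℝ) * (((m : ℝ) / (4 * ((m : ℝ) - 2))) ^ (D + 1) * X (D + 1)) +
                  2 * ((D : ℝ) + 1) * (((m : ℝ) / (4 * ((m : ℝ) - 2))) ^ D * X D)))) +
              2 * ((D : ℝ) + 1) * (((H.card : ℝ) ^ 2 / ((n : ℝ) * ((n : ℝ) - 2))) *
                (G * ((T : ℝ) * (((m : ℝ) / (4 * ((m : ℝ) - 2))) ^ D * X D) +
                  2 * (D : ℝ) * (((m : ℝ) / (4 * ((m : ℝ) - 2))) ^ (D - 1) * X (D - 1)))))))) +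
      (2 : ℝ) ^ (D + 1) * (9 * ((t₁ + 2 * (D + 1) + 2 : ℕ) : ℝ) ^ 2 * G) *
        (((D : ℝ) + 1) * (2 * ((n : ℝ) / 2 + 1) ^ 3 * Real.exp (-((K * Real.sqrt (H.card * D)) ^ 2 / H.card)))) := by
  -- the internal type margin `β₀ = min β (1/5)`
  obtain ⟨β₀, hβ₀⟩ : ∃ e : ℝ, e = min β (1 / 5) := ⟨_, rfl⟩
  have hβ₀pos : 0 < β₀ := by rw [hβ₀]; exact lt_min hβ (by norm_num)
  have hβ₀5 : β₀ ≤ 1 / 5 := by rw [hβ₀]; exact min_le_right _ _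
  have hβ₀β : β₀ ≤ β := by rw [hβ₀]; exact min_le_left _ _
  -- the numeric threshold
  obtain ⟨Pstar, hPstar0, hnum⟩ := bulk_numerics (β := β₀) (K := K) (C₁ := 8) (C₂ := 10) (C₃ := 2048)
    hβ₀pos hβ₀5 hK (by norm_num) (by norm_num) (by norm_num)
  refine ⟨⌈2 * Pstar ^ 8⌉₊ + 2, ?_⟩
  intro n hn t₁ T D Bv C w hdes hDT hbal hD1 hD4 M H haβ hbβ hdβ ψ G hG0 hG lam kap hlam hkap m hm hmn X hX0 hX hψ0
  have hπ : ∀ v, M.2.partner (M.2.partner v) = v := partner_partner M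
  have hπ' : ∀ v, M.2.partner v ≠ v := partner_ne M
  have hst : ∀ v ∈ (univ : Finset (Fin n)), M.2.partner v ∈ univ := fun v _ => mem_univ _
  -- types of `univ`
  obtain ⟨a, ha⟩ : ∃ a : ℕ, (reps M.2.partner (vAA M.2.partner univ H)).card = a := ⟨_, rfl⟩
  obtain ⟨b, hb⟩ : ∃ b : ℕ, (reps M.2.partner (vBH M.2.partner univ H ∪ vBN M.2.partner univ H)).card = b :=
    ⟨_, rfl⟩
  obtain ⟨d, hd⟩ : ∃ d : ℕ, (reps M.2.partner (vDD M.2.partner univ H)).card = d := ⟨_, rfl⟩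
  obtain ⟨N₀, hN⟩ : ∃ N₀ : ℕ, a + b + d = N₀ := ⟨_, rfl⟩
  have hn2 : n = 2 * N₀ := by
    have h := two_mul_typeReps_eq_card hπ hπ' hst H
    rw [ha, hb, hd, card_univ, Fintype.card_fin] at h; omega
  rw [ha] at haβ; rw [hb] at hbβ; rw [hd] at hdβ
  have hnr : (n : ℝ) = 2 * N₀ := by exact_mod_cast hn2
  have hN₀r : (N₀ : ℝ) = (n : ℝ) / 2 := by rw [hnr]; ring
  -- design data: `t` odd, balanced
  obtain ⟨s, hs2⟩ : ∃ s : ℕ, t₁ + 2 * (D + 1) + 2 = 2 * s + 1 := hdes.1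
  have htn : 2 * (t₁ + 2 * (D + 1) + 2) + 2 ≤ n := hdes.2.1
  have hTt : T ≤ t₁ + 2 * (D + 1) + 2 := hdes.2.2.1
  -- the scale hypotheses of the numerics
  have hn0 : (⌈2 * Pstar ^ 8⌉₊ : ℝ) + 2 ≤ n := by exact_mod_cast hn
  have hceil := Nat.le_ceil (2 * Pstar ^ 8)
  have hN₀1 : (1 : ℝ) ≤ N₀ := by rw [hN₀r]; linarith
  have hPN : Pstar ≤ (N₀ : ℝ) ^ ((8 : ℕ) : ℝ)⁻¹ :=
    le_rpow_inv_eight hPstar0 (by rw [hN₀r]; linarith)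
  have hD4r : ((D : ℝ)) ^ 4 ≤ 2 * N₀ := by rw [← hnr]; exact_mod_cast hD4
  -- `|H| = 2a + b ≤ n`
  have hHcard : (H.card : ℝ) = 2 * a + b := by
    have := card_eq_two_mul_add_of_types hπ hπ' H
    rw [ha, hb] at this; exact_mod_cast this
  have hHn : (H.card : ℝ) ≤ n := by
    have h := card_le_univ H
    rw [Fintype.card_fin] at h
    exact_mod_cast h
  have hHpos : 0 < (H.card : ℝ) := by
    rw [hHcard]
    have : (0 : ℝ) ≤ a := Nat.cast_nonneg _
    have : (0 : ℝ) < b := by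
      have : (0 : ℝ) < β * n / 2 + 2 * D + 1 := by positivity
      linarith
    linarith
  -- the window `ε = K√(|H|D)` (opaque name, definitional for the final `exact`)
  obtain ⟨ε, hεdef⟩ : ∃ e : ℝ, e = K * Real.sqrt (H.card * D) := ⟨_, rfl⟩
  have hε0 : 0 ≤ ε := by rw [hεdef]; exact mul_nonneg hK (Real.sqrt_nonneg _)
  have hεK : ε ≤ K * Real.sqrt (2 * N₀ * D) := by
    rw [hεdef]
    refine mul_le_mul_of_nonneg_left (Real.sqrt_le_sqrt ?_) hK
    rw [← hnr]; exact mul_le_mul_of_nonneg_right hHn (Nat.cast_nonneg _)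
  -- the numerics
  obtain ⟨E, hE⟩ : ∃ e : ℝ, e = 8 * (ε + 1 + 10) ^ 2 / (β₀ ^ 4 * ((N₀ : ℝ) - 1)) := ⟨_, rfl⟩
  obtain ⟨R, hR⟩ : ∃ e : ℝ, e = E + Real.log (2 * 2048) + 2 * Real.log N₀ + D := ⟨_, rfl⟩
  obtain ⟨L, hL⟩ : ∃ e : ℝ, e = 2 * D + Real.sqrt (4 * N₀ * R) := ⟨_, rfl⟩
  obtain ⟨c1, c2, c3, c4, c5, c6, c7, c8, c9, c10, c11, c12, c13, -, c15, c16⟩ :=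
    hnum N₀ hPN hN₀1 D hD1 hD4r ε hε0 hεK E R L hE hR hL
  -- margins in `β₀`
  have hβ₀N : β₀ * N₀ ≤ β * n / 2 := by
    rw [hN₀r]
    have : β₀ * ((n : ℝ) / 2) ≤ β * ((n : ℝ) / 2) := mul_le_mul_of_nonneg_right hβ₀β (by positivity)
    linarith
  have haβ' : β₀ * N₀ + 1 ≤ a := by have : (0:ℝ) ≤ D := Nat.cast_nonneg _; linarith
  have hbβ' : β₀ * N₀ + 2 * D + 1 ≤ b := by linarith
  have hdβ' : β₀ * N₀ + 2 * D + 1 ≤ d := by linarith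
  -- `s` is balanced
  have htr : ((t₁ + 2 * (D + 1) + 2 : ℕ) : ℝ) = 2 * s + 1 := by exact_mod_cast hs2
  have hbalr : (n : ℝ) ≤ 4 * (2 * s + 1) := by
    have : (n : ℝ) ≤ 4 * ((t₁ + 2 * (D + 1) + 2 : ℕ) : ℝ) := by exact_mod_cast hbal
    rwa [htr] at this
  have htnr : 2 * (2 * (s : ℝ) + 1) + 2 ≤ n := by
    have : 2 * ((t₁ + 2 * (D + 1) + 2 : ℕ) : ℝ) + 2 ≤ n := by exact_mod_cast htn
    rwa [htr] at this
  have hs_lo : β₀ * N₀ + D ≤ s := by rw [hnr] at hbalr; linarith only [hbalr, c11]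
  have hs_hi : 8 * (s : ℝ) ≤ (4 + β₀) * ((N₀ : ℝ) - 2 * D) := by rw [hnr] at htnr; linarith only [htnr, c12]
  -- apply brick 123 with `ε = K√(|H|D)`
  rw [← hεdef]
  refine crossingPlane_value_le_of_relSmooth_window hdes hDT M H ψ hG0 hG lam kap hlam hkap hm hmn X hX0 hX hψ0
    hε0 ?_
  -- [BULK] at every window point
  intro x hx hwin
  obtain ⟨hx0, hxt⟩ := mem_Icc.1 hx
  obtain ⟨x', rfl⟩ : ∃ x' : ℕ, x = (x' : ℤ) := ⟨x.toNat, (Int.toNat_of_nonneg hx0).symm⟩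
  have hwin' : |(x' : ℝ) - (2 * (s : ℝ) + 1) * H.card / n| < ε := by
    rw [htr] at hwin; simpa using hwin
  -- the lower bound (window lower bound of the level-1 law, Literature)
  have hN₀pos : (0 : ℝ) < N₀ := by linarith only [hN₀1]
  have hxwin : |(x' : ℝ) - (2 * (s : ℝ) + 1) * (2 * a + b) / (2 * N₀)| < ε := by
    rw [← hHcard, ← hnr]; exact hwin'
  have hy : |(x' : ℝ) - s * (2 * a + b) / N₀| ≤ ε + 1 :=
    window_centre hN₀pos (by positivity) (by
      have h1 : ((a + b + d : ℕ) : ℝ) = N₀ := by rw [hN]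
      push_cast at h1
      linarith only [h1, Nat.cast_nonneg (α := ℝ) d]) hxwin
  have hD0 : (0 : ℝ) ≤ D := Nat.cast_nonneg _
  have hs' : 8 * (s : ℝ) ≤ (4 + β₀) * N₀ := by
    have : 0 ≤ (4 + β₀) * (2 * (D : ℝ)) := mul_nonneg (by linarith only [hβ₀pos]) (by positivity)
    linarith only [hs_hi, this]
  have hLB := shellLaw_one_window_lower hπ hπ' hst H ha hb hd hN hβ₀pos (by linarith only [hβ₀5]) haβ'
    (by linarith only [hbβ', hD0]) (by linarith only [hdβ', hD0]) (s := s) (by linarith only [hs_lo, hD0]) hs'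
    hy c15 c16
  rw [show 1 + 2 * s = 2 * s + 1 by ring] at hLB
  -- the finite assembly
  have hxD : 2 * D ≤ x' := by
    -- `x' > (2s+1)|H|/n − ε ≥ β₀N₀/4 − ε ≥ 2D`
    have h1 : β₀ * N₀ / 4 ≤ (2 * (s : ℝ) + 1) * H.card / n := by
      rw [hnr, hHcard]
      rw [le_div_iff₀ (by positivity)]
      have hb0 : β₀ * N₀ ≤ 2 * (a : ℝ) + b := by
        linarith only [hbβ', hD0, Nat.cast_nonneg (α := ℝ) a, mul_pos hβ₀pos hN₀pos]
      have hs0 : (N₀ : ℝ) / 2 ≤ 2 * s + 1 := by rw [hnr] at hbalr; linarith only [hbalr]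
      have h3 := mul_le_mul hs0 hb0 (by positivity) (by positivity)
      have e : (N₀ : ℝ) / 2 * (β₀ * N₀) = β₀ * N₀ / 4 * (2 * N₀) := by ring
      linarith only [h3, e]
    have h2 := (abs_lt.1 hwin').1
    have h4 : (2 * D : ℝ) ≤ x' := by linarith only [h1, h2, c13]
    exact_mod_cast h4
  have hne : ∀ k, k ≤ D → (shellIn M.2.partner univ (2 * s + 1) (1 + 2 * k)).Nonempty := by
    intro k hk
    rw [shellIn_univ, ← hs2]
    exact shell_partner_nonempty M hdes.1 ⟨k, by ring⟩ (by omega) (by omega)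
  have c1' : 16 * D + 16 ≤ N₀ := by exact_mod_cast c1
  have h := relSmooth_of_hyps hπ hπ' H ha hb hd hN hn2 hβ₀pos (by linarith only [hβ₀5]) c1' hbβ' hdβ' hs_lo hs_hi
    hne
    hwin' hxD c2 c3 c4 c5 c6 c7 c8 c9 hLB (by rw [hE] at c10; exact c10)
  rw [hs2]
  exact h

end Summit.PneNP.PneNP.Theorems.ChebyshevTracialDesignCrossingPlaneUnconditional
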